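import Summits.AtomisticToContinuum.Crystallization.Theorems.ExcessDecayLiouvilleLinearChain
import Summits.AtomisticToContinuum.Crystallization.Theorems.ExcessDecayLiouvilleDiscreteSobolev3D

/-!
# Route `ExcessDecayLiouville`: pointwise bounds from the chained levels (linear levels, V)

Linear half of the harmonic-replacement architecture for item `ExcessDecay` (stmt-AtomisticToContinuum-9334).
The tensor discrete Sobolev inequality `norm_sq_le_tensor_three` on the lattice box
`(i,j,k) ↦ x₀ + A z(i,j,k)`, `0 ≤ i,j,k ≤ ⌊R⌋`, turns the local masses of a field and of its forward
differences of orders `≤ 3` into a pointwise bound at `x₀`: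

* `boxPoint_succ`, `boxPoint_mem`, `dist_boxPoint_le`, `boxPoint_injective` : the box map;
* `boxSum_le_mass` : a box sum of `‖F‖²` is at most the local mass `M(F; X)` once `dist x₀ c₀ + 4⌊R⌋ ≤ X`;
* `sup_sq_le_boxMasses` : `‖g x₀‖² ≤ 8R⁻³ M(g;X) + 8R⁻¹ Σ_e M(Δ_e g;X) + 8R Σ M(Δ_eΔ_{e'} g;X) + 8R³ M(Δ³ g;X)`
  for `x₀ ∈ S ∩ B_R(c₀)`, `X ≥ 5R`;
* `sup_sq_le_of_harmonic` : for `g` finitely supported with zero operator rows on `dist · c₀ ≤ ρ_g`,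
  `ρ_g ≥ 160R + 170`, `R ≥ 2`: `‖g x₀‖² ≤ 64 L³ R⁻³ M(g; 320R+340) + 536 L³ R³ J_{10R+10}(g)`.

All `[folklore]`; helper lemmas, nothing here closes an item.
-/

noncomputable section

namespace Summit.AtomisticToContinuum.Crystallization.Theorems.ExcessDecayLiouville

open scoped BigOperators Topology InnerProductSpace RealInnerProductSpace Classical
open Literature.MathematicalPhysics.StatisticalMechanics
open Summit.AtomisticToContinuum.Crystallization.Theorems.PhononStabilityNegative

-- Local notation: the force-constant map `K(e)w = h(|e|²)w + 2⟪e,w⟫h′(|e|²)e`.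
local notation3 "𝕂[" e "] " w:max =>
  (-((‖e‖ ^ 2)⁻¹) ^ 7 + ((‖e‖ ^ 2)⁻¹) ^ 4) • w + (2 * ⟪e, w⟫ * (7 * ((‖e‖ ^ 2)⁻¹) ^ 8 - 4 * ((‖e‖ ^ 2)⁻¹) ^ 5)) • e
set_option quotPrecheck false in
local notation "𝟙ᵇ[" x ", " c ", " R "]" => (if dist (x : EuclideanSpace ℝ (Fin 3)) c ≤ R then (1 : ℝ) else 0)
-- the three forward generators of `Λ₀` and the integer lattice vector
local notation "𝐮₁" => (triangularVec₁ 1 : EuclideanSpace ℝ (Fin 3))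
local notation "𝐮₂" => (triangularVec₂ 1 : EuclideanSpace ℝ (Fin 3))
local notation "𝐰₃" => (layerNormal (2 * Real.sqrt (2 / 3)) : EuclideanSpace ℝ (Fin 3))
local notation "𝐳[" i ", " j ", " k "]" =>
  (((i : ℤ) : ℝ) • (triangularVec₁ 1 : EuclideanSpace ℝ (Fin 3)) + ((j : ℤ) : ℝ) • triangularVec₂ 1 +
    ((k : ℤ) : ℝ) • layerNormal (2 * Real.sqrt (2 / 3)))
-- the constants of one level in mass form
local notation "Cₐ" => (19 * (1024 / ((23 / 25 : ℝ) ^ 3 * (23 / 25 : ℝ) ^ 3)) + 38 * (1024 / (23 / 25 : ℝ) ^ 3))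
local notation "Cⱼ" => (9961472 : ℝ)

section

variable {t : Fin 2 → (EuclideanSpace ℝ (Fin 3))} {A : (EuclideanSpace ℝ (Fin 3)) →L[ℝ] (EuclideanSpace ℝ (Fin 3))}
  {c₀ : EuclideanSpace ℝ (Fin 3)} {κ : ℝ}

set_option quotPrecheck false in
-- Local notation: the operator row `(L v)(p)`.
local notation "𝕃" v:max " @ " p:max =>
  tsum (fun q : Sites₀ t A => (if ((p : Sites₀ t A) : EuclideanSpace ℝ (Fin 3)) ≠ q then
    𝕂[((p : Sites₀ t A) : EuclideanSpace ℝ (Fin 3)) - q] (v ((p : Sites₀ t A) : EuclideanSpace ℝ (Fin 3)) - v q) else 0))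
set_option quotPrecheck false in
-- local mass on the ball of radius `X` about the section centre `c₀`
local notation "𝐌[" f ", " X "]" =>
  tsum (fun p : Sites₀ t A => ‖f (p : EuclideanSpace ℝ (Fin 3))‖ ^ 2 * 𝟙ᵇ[p, c₀, X])
set_option quotPrecheck false in
-- weighted far mass with floor `Y` about `c₀`
local notation "𝐉[" f ", " Y "]" =>
  tsum (fun q : Sites₀ t A => ‖f (q : EuclideanSpace ℝ (Fin 3))‖ ^ 2 * (max (dist (q : EuclideanSpace ℝ (Fin 3)) c₀) Y)⁻¹ ^ 8)
set_option quotPrecheck false in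
-- lattice difference
local notation "Δ[" τ "] " f:max => (fun x : EuclideanSpace ℝ (Fin 3) => f (x + A τ) - f x)
set_option quotPrecheck false in
-- the level constant `L = (4Cₐ + 24Cⱼ)/κ + 1`
local notation "𝐋" => ((4 * Cₐ + 24 * Cⱼ) / κ + 1)
set_option quotPrecheck false in
-- the box map based at `x₀` (a binder of each statement)
local notation "𝛗[" x₀ ", " i ", " j ", " k "]" => (x₀ + A 𝐳[((i : ℕ) : ℤ), ((j : ℕ) : ℤ), ((k : ℕ) : ℤ)])

/-! ## The box map -/

/-- Coordinate successors of the box map are translations by the generators. [folklore] -/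
theorem boxPoint_succ (x₀ : EuclideanSpace ℝ (Fin 3)) (i j k : ℕ) :
    𝛗[x₀, i + 1, j, k] = 𝛗[x₀, i, j, k] + A 𝐮₁ ∧ 𝛗[x₀, i, j + 1, k] = 𝛗[x₀, i, j, k] + A 𝐮₂ ∧
      𝛗[x₀, i, j, k + 1] = 𝛗[x₀, i, j, k] + A 𝐰₃ := by
  obtain ⟨h1, h2, h3⟩ := latticeVec_succ (i : ℤ) (j : ℤ) (k : ℤ)
  refine ⟨?_, ?_, ?_⟩
  · rw [Nat.cast_succ, h1, map_add]; exact (add_assoc _ _ _).symm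
  · rw [Nat.cast_succ, h2, map_add]; exact (add_assoc _ _ _).symm
  · rw [Nat.cast_succ, h3, map_add]; exact (add_assoc _ _ _).symm

/-- Box points are sites (when `x₀` is). [folklore] -/
theorem boxPoint_mem {x₀ : EuclideanSpace ℝ (Fin 3)} (hx₀ : x₀ ∈ Sites₀ t A) (i j k : ℕ) :
    𝛗[x₀, i, j, k] ∈ Sites₀ t A :=
  add_mem_sites₀ hx₀ (latticeVec_mem_Λ₀ _ _ _)

/-- Box points of index `≤ n` are within `4n` of the base point. [folklore] -/
theorem dist_boxPoint_le (hA : Adm₀ A) (x₀ c : EuclideanSpace ℝ (Fin 3)) {n i j k : ℕ} (hi : i ≤ n) (hj : j ≤ n)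
    (hk : k ≤ n) : dist 𝛗[x₀, i, j, k] c ≤ dist x₀ c + 4 * n := by
  have h1 := dist_triangle 𝛗[x₀, i, j, k] x₀ c
  have h2 : dist 𝛗[x₀, i, j, k] x₀ = ‖A 𝐳[((i : ℕ) : ℤ), ((j : ℕ) : ℤ), ((k : ℕ) : ℤ)]‖ := by
    rw [dist_eq_norm, add_sub_cancel_left]
  have h3 : ‖A 𝐳[((i : ℕ) : ℤ), ((j : ℕ) : ℤ), ((k : ℕ) : ℤ)]‖ ≤ 4 * n := by
    have hz := norm_latticeVec_le (i : ℤ) (j : ℤ) (k : ℤ)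
    have hi' : |(((i : ℕ) : ℤ) : ℝ)| ≤ n := by
      rw [Int.cast_natCast, Nat.abs_cast]; exact_mod_cast hi
    have hj' : |(((j : ℕ) : ℤ) : ℝ)| ≤ n := by
      rw [Int.cast_natCast, Nat.abs_cast]; exact_mod_cast hj
    have hk' : |(((k : ℕ) : ℤ) : ℝ)| ≤ n := by
      rw [Int.cast_natCast, Nat.abs_cast]; exact_mod_cast hk
    calc ‖A 𝐳[((i : ℕ) : ℤ), ((j : ℕ) : ℤ), ((k : ℕ) : ℤ)]‖ ≤ ‖A‖ * ‖𝐳[((i : ℕ) : ℤ), ((j : ℕ) : ℤ), ((k : ℕ) : ℤ)]‖ :=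
          A.le_opNorm _
      _ ≤ 1 * (4 * n) := by
          refine mul_le_mul ((norm_le_of_adm₀ hA).trans (by norm_num)) (by linarith) (norm_nonneg _) zero_le_one
      _ = 4 * n := one_mul _
  linarith

/-- The box map is injective. [folklore] -/
theorem boxPoint_injective (hA : Adm₀ A) (x₀ : EuclideanSpace ℝ (Fin 3)) {i j k i' j' k' : ℕ}
    (h : 𝛗[x₀, i, j, k] = 𝛗[x₀, i', j', k']) : i = i' ∧ j = j' ∧ k = k' := by
  have h1 := injective_of_adm₀ hA (add_left_cancel h)
  obtain ⟨hi, hj, hk⟩ := latticeCoords_eq h1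
  exact ⟨by exact_mod_cast hi, by exact_mod_cast hj, by exact_mod_cast hk⟩

/-! ## Box sums are bounded by local masses -/

/-- **A box sum of `‖F‖²` is at most the local mass**: for `x₀ ∈ S`, ranges `a, b, c ≤ n + 1` and
`dist x₀ c₀ + 4n ≤ X`, `Σ_{k<a} Σ_{i<b} Σ_{j<c} ‖F(x₀ + A z(i,j,k))‖² ≤ M(F; X)`. [folklore] -/
theorem boxSum_le_mass (hA : Adm₀ A) (hI : Inner₀ t A) (F : (EuclideanSpace ℝ (Fin 3)) → (EuclideanSpace ℝ (Fin 3)))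
    {x₀ : EuclideanSpace ℝ (Fin 3)} (hx₀ : x₀ ∈ Sites₀ t A) {n a b c : ℕ} (ha : a ≤ n + 1) (hb : b ≤ n + 1)
    (hc : c ≤ n + 1) {X : ℝ} (hX : dist x₀ c₀ + 4 * n ≤ X) :
    ∑ k ∈ Finset.range a, ∑ i ∈ Finset.range b, ∑ j ∈ Finset.range c, ‖F 𝛗[x₀, i, j, k]‖ ^ 2 ≤ 𝐌[F, X] := by
  set I := Finset.range a ×ˢ (Finset.range b ×ˢ Finset.range c) with hIdef
  set ψ : ℕ × ℕ × ℕ → EuclideanSpace ℝ (Fin 3) := fun x => 𝛗[x₀, x.2.1, x.2.2, x.1] with hψ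
  have hmemI : ∀ x ∈ I, x.1 ≤ n ∧ x.2.1 ≤ n ∧ x.2.2 ≤ n := by
    intro x hx
    simp only [hIdef, Finset.mem_product, Finset.mem_range] at hx
    omega
  have key := sum_le_localMass hA hI F c₀ X I ψ (fun x _ => boxPoint_mem hx₀ _ _ _)
    (fun x hx => by
      obtain ⟨h1, h2, h3⟩ := hmemI x hx
      exact (dist_boxPoint_le hA x₀ c₀ h2 h3 h1).trans hX)
    (by
      intro x hx y hy hxy
      obtain ⟨h1, h2, h3⟩ := boxPoint_injective hA x₀ hxy
      exact Prod.ext h3 (Prod.ext h1 h2))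
  have heq : ∑ x ∈ I, ‖F (ψ x)‖ ^ 2 =
      ∑ k ∈ Finset.range a, ∑ i ∈ Finset.range b, ∑ j ∈ Finset.range c, ‖F 𝛗[x₀, i, j, k]‖ ^ 2 := by
    rw [hIdef, Finset.sum_product]
    refine Finset.sum_congr rfl fun k _ => ?_
    rw [Finset.sum_product]
  rw [← heq]
  exact key

/-! ## The pointwise bound from the box masses -/

/-- Weight bookkeeping for the tensor Sobolev inequality: monotone in the weights and in the eight box sums.
[folklore] -/
theorem tensorWeights_le {c₁ c₂ a b T₀ T₁ T₂ T₃ T₁₂ T₂₃ T₁₃ T₁₂₃ M₀ M₁ M₂ M₃ M₁₂ M₂₃ M₁₃ M₁₂₃ : ℝ}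
    (hc₁ : 0 ≤ c₁) (hc₂ : 0 ≤ c₂) (ha : c₁ ≤ a) (hb : c₂ ≤ b)
    (h₀ : 0 ≤ T₀) (h₁ : 0 ≤ T₁) (h₂ : 0 ≤ T₂) (h₃ : 0 ≤ T₃) (h₁₂ : 0 ≤ T₁₂) (h₂₃ : 0 ≤ T₂₃) (h₁₃ : 0 ≤ T₁₃)
    (h₁₂₃ : 0 ≤ T₁₂₃) (g₀ : T₀ ≤ M₀) (g₁ : T₁ ≤ M₁) (g₂ : T₂ ≤ M₂) (g₃ : T₃ ≤ M₃) (g₁₂ : T₁₂ ≤ M₁₂)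
    (g₂₃ : T₂₃ ≤ M₂₃) (g₁₃ : T₁₃ ≤ M₁₃) (g₁₂₃ : T₁₂₃ ≤ M₁₂₃) :
    c₁ * (c₁ * c₁ * T₀ + c₁ * c₂ * T₂ + c₂ * c₁ * T₁ + c₂ * c₂ * T₁₂) +
      c₂ * (c₁ * c₁ * T₃ + c₁ * c₂ * T₂₃ + c₂ * c₁ * T₁₃ + c₂ * c₂ * T₁₂₃) ≤
    a * (a * a * M₀ + a * b * M₂ + b * a * M₁ + b * b * M₁₂) +
      b * (a * a * M₃ + a * b * M₂₃ + b * a * M₁₃ + b * b * M₁₂₃) := by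
  have ha0 : 0 ≤ a := hc₁.trans ha
  have hb0 : 0 ≤ b := hc₂.trans hb
  have hM₀ : 0 ≤ M₀ := h₀.trans g₀
  have hM₁ : 0 ≤ M₁ := h₁.trans g₁
  have hM₂ : 0 ≤ M₂ := h₂.trans g₂
  have hM₃ : 0 ≤ M₃ := h₃.trans g₃
  have hM₁₂ : 0 ≤ M₁₂ := h₁₂.trans g₁₂
  have hM₂₃ : 0 ≤ M₂₃ := h₂₃.trans g₂₃
  have hM₁₃ : 0 ≤ M₁₃ := h₁₃.trans g₁₃
  have hM₁₂₃ : 0 ≤ M₁₂₃ := h₁₂₃.trans g₁₂₃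
  gcongr


/-- **Pointwise bound by box masses** (tensor discrete Sobolev inequality on the box at `x₀` of side `⌊R⌋`):
for `x₀ ∈ S ∩ B_R(c₀)`, `R ≥ 1`, `X ≥ 5R`,
`‖g x₀‖² ≤ 8R⁻³ M(g;X) + 8R⁻¹ [M(Δ_{u₁}g;X) + M(Δ_{u₂}g;X) + M(Δ_{w₃}g;X)]`
`  + 8R [M(Δ_{u₂}Δ_{u₁}g;X) + M(Δ_{w₃}Δ_{u₂}g;X) + M(Δ_{w₃}Δ_{u₁}g;X)] + 8R³ M(Δ_{w₃}Δ_{u₂}Δ_{u₁}g;X)`. [folklore] -/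
theorem sup_sq_le_boxMasses (hA : Adm₀ A) (hI : Inner₀ t A) (g : (EuclideanSpace ℝ (Fin 3)) → (EuclideanSpace ℝ (Fin 3)))
    {x₀ : EuclideanSpace ℝ (Fin 3)} (hx₀ : x₀ ∈ Sites₀ t A) {R : ℝ} (hR : 1 ≤ R) (hxR : dist x₀ c₀ ≤ R) {X : ℝ}
    (hX : 5 * R ≤ X) :
    ‖g x₀‖ ^ 2 ≤ 8 / R ^ 3 * 𝐌[g, X] +
      8 / R * (𝐌[Δ[𝐮₁] g, X] + 𝐌[Δ[𝐮₂] g, X] + 𝐌[Δ[𝐰₃] g, X]) +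
      8 * R * (𝐌[Δ[𝐮₂] (Δ[𝐮₁] g), X] + 𝐌[Δ[𝐰₃] (Δ[𝐮₂] g), X] + 𝐌[Δ[𝐰₃] (Δ[𝐮₁] g), X]) +
      8 * R ^ 3 * 𝐌[Δ[𝐰₃] (Δ[𝐮₂] (Δ[𝐮₁] g)), X] := by
  set n := ⌊R⌋₊ with hn
  have hR0 : 0 < R := by linarith
  have hn1 : R < (n : ℝ) + 1 := Nat.lt_floor_add_one R
  have hnR : (n : ℝ) ≤ R := Nat.floor_le hR0.le
  have hXn : dist x₀ c₀ + 4 * n ≤ X := by linarith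
  -- the tensor inequality on the box
  have hT := norm_sq_le_tensor_three (fun i j k => g 𝛗[x₀, i, j, k]) (n := n) (Nat.zero_le n) (Nat.zero_le n)
    (Nat.zero_le n)
  have hz := boxPoint_succ (A := A) x₀
  have hzi : ∀ i j k : ℕ, 𝛗[x₀, i + 1, j, k] = 𝛗[x₀, i, j, k] + A 𝐮₁ := fun i j k => (hz i j k).1
  have hzj : ∀ i j k : ℕ, 𝛗[x₀, i, j + 1, k] = 𝛗[x₀, i, j, k] + A 𝐮₂ := fun i j k => (hz i j k).2.1
  have hzk : ∀ i j k : ℕ, 𝛗[x₀, i, j, k + 1] = 𝛗[x₀, i, j, k] + A 𝐰₃ := fun i j k => (hz i j k).2.2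
  have h000 : g 𝛗[x₀, 0, 0, 0] = g x₀ := by
    simp only [Nat.cast_zero, Int.cast_zero, zero_smul, add_zero, map_zero]
  simp only [h000] at hT
  simp only [hzi] at hT
  simp only [hzj] at hT
  simp only [hzk] at hT
  -- the eight box sums are bounded by the masses
  have hle : n ≤ n + 1 := Nat.le_succ n
  have b0 := boxSum_le_mass (c₀ := c₀) hA hI g hx₀ (n := n) le_rfl le_rfl le_rfl hXn
  have b1 := boxSum_le_mass (c₀ := c₀) hA hI (Δ[𝐮₁] g) hx₀ (n := n) le_rfl hle le_rfl hXn
  have b2 := boxSum_le_mass (c₀ := c₀) hA hI (Δ[𝐮₂] g) hx₀ (n := n) le_rfl le_rfl hle hXn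
  have b3 := boxSum_le_mass (c₀ := c₀) hA hI (Δ[𝐰₃] g) hx₀ (n := n) hle le_rfl le_rfl hXn
  have b12 := boxSum_le_mass (c₀ := c₀) hA hI (Δ[𝐮₂] (Δ[𝐮₁] g)) hx₀ (n := n) le_rfl hle hle hXn
  have b23 := boxSum_le_mass (c₀ := c₀) hA hI (Δ[𝐰₃] (Δ[𝐮₂] g)) hx₀ (n := n) hle le_rfl hle hXn
  have b13 := boxSum_le_mass (c₀ := c₀) hA hI (Δ[𝐰₃] (Δ[𝐮₁] g)) hx₀ (n := n) hle hle le_rfl hXn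
  have b123 := boxSum_le_mass (c₀ := c₀) hA hI (Δ[𝐰₃] (Δ[𝐮₂] (Δ[𝐮₁] g))) hx₀ (n := n) hle hle hle hXn
  beta_reduce at b1 b2 b3 b12 b23 b13 b123
  -- rewrite the three mixed box sums whose bracketing differs from the iterated-difference form
  have e23 : ∑ k ∈ Finset.range n, ∑ i ∈ Finset.range (n + 1), ∑ j ∈ Finset.range n,
      ‖(g (𝛗[x₀, i, j, k] + A 𝐰₃ + A 𝐮₂) - g (𝛗[x₀, i, j, k] + A 𝐮₂)) - (g (𝛗[x₀, i, j, k] + A 𝐰₃) - g 𝛗[x₀, i, j, k])‖ ^ 2 =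
      ∑ k ∈ Finset.range n, ∑ i ∈ Finset.range (n + 1), ∑ j ∈ Finset.range n,
      ‖(g (𝛗[x₀, i, j, k] + A 𝐰₃ + A 𝐮₂) - g (𝛗[x₀, i, j, k] + A 𝐰₃)) - (g (𝛗[x₀, i, j, k] + A 𝐮₂) - g 𝛗[x₀, i, j, k])‖ ^ 2 := by
    refine Finset.sum_congr rfl fun k _ => Finset.sum_congr rfl fun i _ => Finset.sum_congr rfl fun j _ => ?_
    refine congrArg (fun v : EuclideanSpace ℝ (Fin 3) => ‖v‖ ^ 2) ?_
    abel
  have e13 : ∑ k ∈ Finset.range n, ∑ i ∈ Finset.range n, ∑ j ∈ Finset.range (n + 1),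
      ‖(g (𝛗[x₀, i, j, k] + A 𝐰₃ + A 𝐮₁) - g (𝛗[x₀, i, j, k] + A 𝐮₁)) - (g (𝛗[x₀, i, j, k] + A 𝐰₃) - g 𝛗[x₀, i, j, k])‖ ^ 2 =
      ∑ k ∈ Finset.range n, ∑ i ∈ Finset.range n, ∑ j ∈ Finset.range (n + 1),
      ‖(g (𝛗[x₀, i, j, k] + A 𝐰₃ + A 𝐮₁) - g (𝛗[x₀, i, j, k] + A 𝐰₃)) - (g (𝛗[x₀, i, j, k] + A 𝐮₁) - g 𝛗[x₀, i, j, k])‖ ^ 2 := by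
    refine Finset.sum_congr rfl fun k _ => Finset.sum_congr rfl fun i _ => Finset.sum_congr rfl fun j _ => ?_
    refine congrArg (fun v : EuclideanSpace ℝ (Fin 3) => ‖v‖ ^ 2) ?_
    abel
  have e123 : ∑ k ∈ Finset.range n, ∑ i ∈ Finset.range n, ∑ j ∈ Finset.range n,
      ‖((g (𝛗[x₀, i, j, k] + A 𝐰₃ + A 𝐮₂ + A 𝐮₁) - g (𝛗[x₀, i, j, k] + A 𝐮₂ + A 𝐮₁)) -
          (g (𝛗[x₀, i, j, k] + A 𝐰₃ + A 𝐮₂) - g (𝛗[x₀, i, j, k] + A 𝐮₂))) -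
        ((g (𝛗[x₀, i, j, k] + A 𝐰₃ + A 𝐮₁) - g (𝛗[x₀, i, j, k] + A 𝐮₁)) -
          (g (𝛗[x₀, i, j, k] + A 𝐰₃) - g 𝛗[x₀, i, j, k]))‖ ^ 2 =
      ∑ k ∈ Finset.range n, ∑ i ∈ Finset.range n, ∑ j ∈ Finset.range n,
      ‖((g (𝛗[x₀, i, j, k] + A 𝐰₃ + A 𝐮₂ + A 𝐮₁) - g (𝛗[x₀, i, j, k] + A 𝐰₃ + A 𝐮₂)) -
          (g (𝛗[x₀, i, j, k] + A 𝐰₃ + A 𝐮₁) - g (𝛗[x₀, i, j, k] + A 𝐰₃))) -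
        ((g (𝛗[x₀, i, j, k] + A 𝐮₂ + A 𝐮₁) - g (𝛗[x₀, i, j, k] + A 𝐮₂)) -
          (g (𝛗[x₀, i, j, k] + A 𝐮₁) - g 𝛗[x₀, i, j, k]))‖ ^ 2 := by
    refine Finset.sum_congr rfl fun k _ => Finset.sum_congr rfl fun i _ => Finset.sum_congr rfl fun j _ => ?_
    refine congrArg (fun v : EuclideanSpace ℝ (Fin 3) => ‖v‖ ^ 2) ?_
    abel
  rw [e23, e13, e123] at hT
  -- weights
  have hc₁ : (0 : ℝ) ≤ 2 / ((n : ℝ) + 1) := by positivity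
  have hc₂ : (0 : ℝ) ≤ 2 * (n : ℝ) := by positivity
  have ha : 2 / ((n : ℝ) + 1) ≤ 2 / R := div_le_div_of_nonneg_left (by norm_num) hR0 hn1.le
  have hb : 2 * (n : ℝ) ≤ 2 * R := by linarith
  have nn3 : ∀ (a b c : ℕ) (F : ℕ → ℕ → ℕ → EuclideanSpace ℝ (Fin 3)),
      (0 : ℝ) ≤ ∑ k ∈ Finset.range a, ∑ i ∈ Finset.range b, ∑ j ∈ Finset.range c, ‖F i j k‖ ^ 2 :=
    fun a b c F => Finset.sum_nonneg fun _ _ => Finset.sum_nonneg fun _ _ => Finset.sum_nonneg fun _ _ => sq_nonneg _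
  have step := tensorWeights_le hc₁ hc₂ ha hb (nn3 _ _ _ _) (nn3 _ _ _ _) (nn3 _ _ _ _) (nn3 _ _ _ _)
    (nn3 _ _ _ _) (nn3 _ _ _ _) (nn3 _ _ _ _) (nn3 _ _ _ _) b0 b1 b2 b3 b12 b23 b13 b123
  have key := hT.trans step
  have hR' : R ≠ 0 := hR0.ne'
  have halg : 2 / R * (2 / R * (2 / R) * 𝐌[g, X] + 2 / R * (2 * R) * 𝐌[Δ[𝐮₂] g, X] + 2 * R * (2 / R) * 𝐌[Δ[𝐮₁] g, X] +
        2 * R * (2 * R) * 𝐌[Δ[𝐮₂] (Δ[𝐮₁] g), X]) +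
      2 * R * (2 / R * (2 / R) * 𝐌[Δ[𝐰₃] g, X] + 2 / R * (2 * R) * 𝐌[Δ[𝐰₃] (Δ[𝐮₂] g), X] +
        2 * R * (2 / R) * 𝐌[Δ[𝐰₃] (Δ[𝐮₁] g), X] + 2 * R * (2 * R) * 𝐌[Δ[𝐰₃] (Δ[𝐮₂] (Δ[𝐮₁] g)), X]) =
      8 / R ^ 3 * 𝐌[g, X] + 8 / R * (𝐌[Δ[𝐮₁] g, X] + 𝐌[Δ[𝐮₂] g, X] + 𝐌[Δ[𝐰₃] g, X]) +
      8 * R * (𝐌[Δ[𝐮₂] (Δ[𝐮₁] g), X] + 𝐌[Δ[𝐰₃] (Δ[𝐮₂] g), X] + 𝐌[Δ[𝐰₃] (Δ[𝐮₁] g), X]) +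
      8 * R ^ 3 * 𝐌[Δ[𝐰₃] (Δ[𝐮₂] (Δ[𝐮₁] g)), X] := by
    field_simp
    ring
  rw [halg] at key
  exact key

/-! ## The pointwise bound for a field with zero operator rows -/

/-- Coefficient bookkeeping: `(8 + 24L + 24L² + 8L³)/R³ ≤ 64L³/R³` and
`24L/R + 168RL² + 344R³L³ ≤ 536L³R³` for `L, R ≥ 1`. [folklore] -/
theorem supCoeffs_le {L R : ℝ} (hL : 1 ≤ L) (hR : 1 ≤ R) :
    8 / R ^ 3 + 24 * L / R ^ 3 + 24 * L ^ 2 / R ^ 3 + 8 * L ^ 3 / R ^ 3 ≤ 64 * L ^ 3 / R ^ 3 ∧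
      24 * L / R + 168 * R * L ^ 2 + 344 * R ^ 3 * L ^ 3 ≤ 536 * L ^ 3 * R ^ 3 := by
  have hR0 : 0 < R := by linarith
  have hL0 : 0 ≤ L := by linarith
  have hL2 : L ≤ L ^ 2 := by nlinarith
  have hL3 : L ^ 2 ≤ L ^ 3 := by nlinarith
  have hL13 : L ≤ L ^ 3 := hL2.trans hL3
  have hR3 : R ≤ R ^ 3 := by
    have := pow_le_pow_right₀ hR (by norm_num : 1 ≤ 3)
    rwa [pow_one] at this
  have hR31 : 1 ≤ R ^ 3 := one_le_pow₀ hR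
  have hR4 : 1 ≤ R ^ 3 * R := one_le_mul_of_one_le_of_one_le hR31 hR
  constructor
  · rw [← add_div, ← add_div, ← add_div]
    exact div_le_div_of_nonneg_right (by nlinarith) (by positivity)
  · have h1 : 24 * L / R ≤ 24 * L ^ 3 * R ^ 3 := by
      rw [div_le_iff₀ hR0]
      have : L ≤ L ^ 3 * (R ^ 3 * R) := by
        calc L ≤ L ^ 3 := hL13
          _ = L ^ 3 * 1 := (mul_one _).symm
          _ ≤ L ^ 3 * (R ^ 3 * R) := by gcongr
      nlinarith
    have h2 : 168 * R * L ^ 2 ≤ 168 * L ^ 3 * R ^ 3 := by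
      have : R * L ^ 2 ≤ R ^ 3 * L ^ 3 := mul_le_mul hR3 hL3 (by positivity) (by positivity)
      nlinarith
    nlinarith

/-- **Pointwise bound for a field with zero operator rows**: for `g` finitely supported with zero rows on
`dist · c₀ ≤ ρ_g`, `R ≥ 2`, `ρ_g ≥ 160R + 170` and `x₀ ∈ S ∩ B_R(c₀)`,
`‖g x₀‖² ≤ 64 L³ R⁻³ M(g; 320R+340) + 536 L³ R³ J_{10R+10}(g)`. [folklore] -/
theorem sup_sq_le_of_harmonic (hA : Adm₀ A) (hI : Inner₀ t A) (hκ0 : 0 < κ)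
    (hκ : ∀ v : (EuclideanSpace ℝ (Fin 3)) → (EuclideanSpace ℝ (Fin 3)), (Function.support v).Finite →
      Function.support v ⊆ Sites₀ t A → κ * nnForm t A v ≤ ∑' p : Sites₀ t A, ⟪𝕃 v @ p, v p⟫)
    {g : (EuclideanSpace ℝ (Fin 3)) → (EuclideanSpace ℝ (Fin 3))} (hg : (Function.support g).Finite)
    {R : ℝ} (hR : 2 ≤ R) {ρg : ℝ} (hρg : 160 * R + 170 ≤ ρg)
    (hharm : ∀ p : Sites₀ t A, dist (p : EuclideanSpace ℝ (Fin 3)) c₀ ≤ ρg → 𝕃 g @ p = 0)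
    {x₀ : EuclideanSpace ℝ (Fin 3)} (hx₀ : x₀ ∈ Sites₀ t A) (hxR : dist x₀ c₀ ≤ R) :
    ‖g x₀‖ ^ 2 ≤ 64 * 𝐋 ^ 3 / R ^ 3 * 𝐌[g, 320 * R + 340] + 536 * 𝐋 ^ 3 * R ^ 3 * 𝐉[g, 10 * R + 10] := by
  have hR1 : 1 ≤ R := by linarith
  have hR0 : 0 < R := by linarith
  set X : ℝ := 5 * R + 4 with hXdef
  have hX1 : 1 ≤ X := by rw [hXdef]; linarith
  have hXR : R ≤ X := by rw [hXdef]; linarith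
  have hY0 : (0 : ℝ) < 10 * R + 10 := by linarith
  have hY25 : (25 : ℝ) ≤ 10 * R + 10 := by linarith
  have hYX : 10 * R + 10 ≤ 2 * X + 2 := by rw [hXdef]; linarith
  have base := sup_sq_le_boxMasses (c₀ := c₀) hA hI g hx₀ hR1 hxR (X := X) (by rw [hXdef]; linarith)
  obtain ⟨hL1, -, -, -⟩ := levelConst_le (κ := κ) hκ0
  have hL0 : 0 ≤ 𝐋 := by linarith
  set Mb := 𝐌[g, 320 * R + 340] with hMb
  set J := 𝐉[g, 10 * R + 10] with hJ
  have hM0 : 0 ≤ Mb := mass_nonneg g _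
  have hJ0 : 0 ≤ J := farMass_nonneg g _ hY0
  have hu1 : (𝐮₁ : EuclideanSpace ℝ (Fin 3)) = 𝐮₁ ∨ 𝐮₁ = 𝐮₂ ∨ 𝐮₁ = 𝐰₃ := Or.inl rfl
  have hu2 : (𝐮₂ : EuclideanSpace ℝ (Fin 3)) = 𝐮₁ ∨ 𝐮₂ = 𝐮₂ ∨ 𝐮₂ = 𝐰₃ := Or.inr (Or.inl rfl)
  have hw3 : (𝐰₃ : EuclideanSpace ℝ (Fin 3)) = 𝐮₁ ∨ 𝐰₃ = 𝐮₂ ∨ 𝐰₃ = 𝐰₃ := Or.inr (Or.inr rfl)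
  -- masses at radius X in terms of the big mass and the far mass
  have m0 : 𝐌[g, X] ≤ Mb := mass_mono hA hI g (by rw [hXdef]; linarith)
  have hfr1 : 𝐋 / X ^ 2 ≤ 𝐋 / R ^ 2 := div_le_div_of_nonneg_left hL0 (by positivity) (pow_le_pow_left₀ hR0.le hXR 2)
  have hfr2 : 𝐋 ^ 2 / X ^ 4 ≤ 𝐋 ^ 2 / R ^ 4 :=
    div_le_div_of_nonneg_left (by positivity) (by positivity) (pow_le_pow_left₀ hR0.le hXR 4)
  have hfr3 : 𝐋 ^ 3 / X ^ 6 ≤ 𝐋 ^ 3 / R ^ 6 :=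
    div_le_div_of_nonneg_left (by positivity) (by positivity) (pow_le_pow_left₀ hR0.le hXR 6)
  have m1 : ∀ {e : EuclideanSpace ℝ (Fin 3)}, (e = 𝐮₁ ∨ e = 𝐮₂ ∨ e = 𝐰₃) →
      𝐌[Δ[e] g, X] ≤ 𝐋 / R ^ 2 * Mb + 𝐋 * J := by
    intro e he
    have h := mass_diff_le₁ hA hI hκ0 hκ hg hX1 (ρg := ρg) (by rw [hXdef]; linarith) hharm he hY0 hYX
    have hm : 𝐌[g, 4 * X + 4] ≤ Mb := mass_mono hA hI g (by rw [hXdef]; linarith)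
    have hm0 : 0 ≤ 𝐌[g, 4 * X + 4] := mass_nonneg g _
    calc 𝐌[Δ[e] g, X] ≤ 𝐋 / X ^ 2 * 𝐌[g, 4 * X + 4] + 𝐋 * J := h
      _ ≤ 𝐋 / R ^ 2 * Mb + 𝐋 * J := by gcongr
  have m2 : ∀ {e e' : EuclideanSpace ℝ (Fin 3)}, (e = 𝐮₁ ∨ e = 𝐮₂ ∨ e = 𝐰₃) → (e' = 𝐮₁ ∨ e' = 𝐮₂ ∨ e' = 𝐰₃) →
      𝐌[Δ[e] (Δ[e'] g), X] ≤ 𝐋 ^ 2 / R ^ 4 * Mb + 7 * 𝐋 ^ 2 * J := by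
    intro e e' he he'
    have h := mass_diff_le₂ hA hI hκ0 hκ hg hX1 (ρg := ρg) (by rw [hXdef]; linarith) hharm he he' hY25 hYX
    have hm : 𝐌[g, 16 * X + 20] ≤ Mb := mass_mono hA hI g (by rw [hXdef]; linarith)
    have hm0 : 0 ≤ 𝐌[g, 16 * X + 20] := mass_nonneg g _
    calc 𝐌[Δ[e] (Δ[e'] g), X] ≤ 𝐋 ^ 2 / X ^ 4 * 𝐌[g, 16 * X + 20] + 7 * 𝐋 ^ 2 * J := h
      _ ≤ 𝐋 ^ 2 / R ^ 4 * Mb + 7 * 𝐋 ^ 2 * J := by gcongr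
  have m3 : 𝐌[Δ[𝐰₃] (Δ[𝐮₂] (Δ[𝐮₁] g)), X] ≤ 𝐋 ^ 3 / R ^ 6 * Mb + 43 * 𝐋 ^ 3 * J := by
    have h := mass_diff_le₃ hA hI hκ0 hκ hg hX1 (ρg := ρg) (by rw [hXdef]; linarith) hharm hw3 hu2 hu1 hY25 hYX
    have hm : 𝐌[g, 64 * X + 84] ≤ Mb := mass_mono hA hI g (by rw [hXdef]; linarith)
    have hm0 : 0 ≤ 𝐌[g, 64 * X + 84] := mass_nonneg g _
    calc 𝐌[Δ[𝐰₃] (Δ[𝐮₂] (Δ[𝐮₁] g)), X] ≤ 𝐋 ^ 3 / X ^ 6 * 𝐌[g, 64 * X + 84] + 43 * 𝐋 ^ 3 * J := h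
      _ ≤ 𝐋 ^ 3 / R ^ 6 * Mb + 43 * 𝐋 ^ 3 * J := by gcongr
  obtain ⟨hc1, hc2⟩ := supCoeffs_le hL1 hR1
  calc ‖g x₀‖ ^ 2 ≤ 8 / R ^ 3 * 𝐌[g, X] + 8 / R * (𝐌[Δ[𝐮₁] g, X] + 𝐌[Δ[𝐮₂] g, X] + 𝐌[Δ[𝐰₃] g, X]) +
        8 * R * (𝐌[Δ[𝐮₂] (Δ[𝐮₁] g), X] + 𝐌[Δ[𝐰₃] (Δ[𝐮₂] g), X] + 𝐌[Δ[𝐰₃] (Δ[𝐮₁] g), X]) +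
        8 * R ^ 3 * 𝐌[Δ[𝐰₃] (Δ[𝐮₂] (Δ[𝐮₁] g)), X] := base
    _ ≤ 8 / R ^ 3 * Mb + 8 / R * ((𝐋 / R ^ 2 * Mb + 𝐋 * J) + (𝐋 / R ^ 2 * Mb + 𝐋 * J) + (𝐋 / R ^ 2 * Mb + 𝐋 * J)) +
        8 * R * ((𝐋 ^ 2 / R ^ 4 * Mb + 7 * 𝐋 ^ 2 * J) + (𝐋 ^ 2 / R ^ 4 * Mb + 7 * 𝐋 ^ 2 * J) +
          (𝐋 ^ 2 / R ^ 4 * Mb + 7 * 𝐋 ^ 2 * J)) +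
        8 * R ^ 3 * (𝐋 ^ 3 / R ^ 6 * Mb + 43 * 𝐋 ^ 3 * J) := by
        gcongr
        exacts [m1 hu1, m1 hu2, m1 hw3, m2 hu2 hu1, m2 hw3 hu2, m2 hw3 hu1]
    _ = (8 / R ^ 3 + 24 * 𝐋 / R ^ 3 + 24 * 𝐋 ^ 2 / R ^ 3 + 8 * 𝐋 ^ 3 / R ^ 3) * Mb +
        (24 * 𝐋 / R + 168 * R * 𝐋 ^ 2 + 344 * R ^ 3 * 𝐋 ^ 3) * J := by
        field_simp
        ring
    _ ≤ 64 * 𝐋 ^ 3 / R ^ 3 * Mb + 536 * 𝐋 ^ 3 * R ^ 3 * J := by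
        have h1 := mul_le_mul_of_nonneg_right hc1 hM0
        have h2 := mul_le_mul_of_nonneg_right hc2 hJ0
        linarith

end

end Summit.AtomisticToContinuum.Crystallization.Theorems.ExcessDecayLiouville

end
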